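import Summits.HodgeConjecture.HodgeConjecture.Theorems.BoundaryReadoutPullbackAlgebraicCupDivisor
import Summits.HodgeConjecture.HodgeConjecture.Theorems.BoundaryReadoutPullbackAlgebraicBundlePullback
import Summits.HodgeConjecture.HodgeConjecture.Theorems.BoundaryReadoutPullbackAlgebraicBundleLerayHirsch
import Summits.HodgeConjecture.HodgeConjecture.Theorems.BoundaryReadoutPullbackAlgebraicLerayHirschReadout
import Summits.HodgeConjecture.HodgeConjecture.Theorems.PadicSemiregularLiftHodgeBeyondAnchorsDiagonalPullback
import Literature.AlgebraicTopology.CharacteristicClasses.ProjectiveSpaceLerayHirsch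
import HarnessLib

/-!
# Crux `PullbackAlgebraic` (stmt-HodgeConjecture-1071), line `normal_cone`: the SECTION PULL-BACK,
# unconditionally — a section of a Zariski-locally trivial `ℙʳ`-bundle pulls algebraic classes back to
# algebraic classes

Route `BoundaryReadout` / `QbarEnvelope` of `HodgeConjecture`, crux `PullbackAlgebraic`
(stmt-HodgeConjecture-1071), skeleton `Cruxes/PullbackAlgebraic/Lines/normal_cone.lean`. The former
registered stub `stub_sectionPullback` (Fulton 1998, Thm. 3.3 (b) and Prop. 6.1 / §3.3 "Gysin for
bundles"; Voisin I, Lemma 7.32 and §7.3.3) was reshaped by the lead into four sub-stubs, all of which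
have LANDED: `stub_cupDivisor` (`Nˡ H²ˡ ∪ N¹ H² ⊆ Nˡ⁺¹`), `stub_bundlePullback` (flat `q^*` preserves
the support filtration), `stub_bundleLerayHirsch` (Leray–Hirsch expansion `y = Σ_{b ≤ min r p} ζᵇ ∪ q^* x_b`
for a divisor class `ζ` with `q_*(ζʳ) = c · 1`, `c ≠ 0`) and `stub_lerayHirschReadout` (the coefficients
of an algebraic class are algebraic). This file assembles them (the skeleton's `sectionPullback_of`,
instantiated): for `q : E → X` between smooth projective complex varieties, Zariski-locally over `X`
isomorphic to `U × ℙʳ → U`, and a section `s` (`s ≫ q = 𝟙`),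

  `s^*(Nᵖ H²ᵖ(E(ℂ); ℂ)) ⊆ Nᵖ H²ᵖ(X(ℂ); ℂ)`,

because `s^* y = Σ_b (s^* ζ)ᵇ ∪ x_b` with every `x_b ∈ N^{p-b}` and `s^* ζ ∈ N¹` (`p = 1` pull-back,
Lefschetz (1,1)). It is the hypothesis `hSec` of the landed constant-lift compositions
`Theorems/BoundaryReadoutPullbackAlgebraicConstantLift` and `…DeformationDatum`, now discharged.

* `cupProduct_cupPow_mem_algebraicClasses` — `a ∈ Nˡ`, `d ∈ N¹` ⟹ `a ∪ dʲ ∈ Nˡ⁺ʲ`;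
* `sectionPullback` — **the section pull-back theorem** (no hypothesis beyond the bundle structure).

## References

* [Fulton1998] W. Fulton, Intersection Theory, 2nd ed. (1998), Thm. 3.3 (b), Prop. 6.1, Ex. 19.2.1.
* [VoisinHodgeI2002] C. Voisin, Hodge Theory and Complex Algebraic Geometry I (2002), Lemma 7.32, §7.3.3.
* [HatcherAT2002] A. Hatcher, Algebraic Topology (2002), Thm. 4D.1.
-/

noncomputable section

-- `Summit.HodgeConjecture.HodgeConjecture.…` is the mandated namespace (single-conjunct summit).
set_option linter.dupNamespace false

namespace Summit.HodgeConjecture.HodgeConjecture.Theorems.PullbackAlgebraicNormalCone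

open CategoryTheory AlgebraicGeometry MonoidalCategory CartesianMonoidalCategory
open Literature.AlgebraicGeometry Literature.AlgebraicGeometry.Motives
open Literature.AlgebraicGeometry.HodgeTheory
open Literature.AlgebraicTopology.SingularHomology (cupProduct cupProduct_one cupProduct_assoc
  cupProduct_map cupProduct_gradedComm_holds singularCohomology.one)
open Literature.AlgebraicTopology.CharacteristicClasses (cupPow cupPow_zero cupPow_succ map_cupPow)

namespace SectionPullback

variable {n : ℕ} {X : SchemeOver ℂ}

/-- **Cup product with powers of a divisor class keeps algebraic classes algebraic**:
`a ∈ Nˡ H²ˡ`, `d ∈ N¹ H²` ⟹ `a ∪ dʲ ∈ Nˡ⁺ʲ H²ˡ⁺²ʲ` (iterate the landed `Nˡ ∪ N¹ ⊆ Nˡ⁺¹`,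
`stub_cupDivisor`). [cite: Fulton1998, §2.3 and Cor. 19.2] [cite: VoisinHodgeII2003, Prop. 9.20] -/
theorem cupProduct_cupPow_mem_algebraicClasses (hX : IsSmoothProjective n X)
    {d : complexBetti X (2 * 1)} (hd : d ∈ algebraicClasses X 1) {l : ℕ} {a : complexBetti X (2 * l)}
    (ha : a ∈ algebraicClasses X l) :
    ∀ (j m : ℕ) (_ : l + j = m) (h : 2 * l + 2 * j = 2 * m),
      cupProduct h a (cupPow ℂ d j) ∈ algebraicClasses X m
  | 0, m, hm, h => by
    subst hm
    have h1 : cupProduct h a (cupPow ℂ d 0) = a := cupProduct_one a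
    rw [h1]
    exact ha
  | j + 1, m, hm, h => by
    subst hm
    have ih := cupProduct_cupPow_mem_algebraicClasses hX hd ha j (l + j) rfl (by omega)
    rw [cupPow_succ, ← cupProduct_assoc (show 2 * l + 2 * j = 2 * (l + j) by omega)
      (show 2 * j + 2 = 2 * (j + 1) by omega) (show 2 * (l + j) + 2 * 1 = 2 * (l + j + 1) by omega)]
    exact stub_cupDivisor hX (l + j) _ d ih hd

end SectionPullback

open SectionPullback in
/-- **The section of a Zariski-locally trivial `ℙʳ`-bundle pulls algebraic classes back to algebraic
classes** (Fulton 1998, Thm. 3.3 (b) / Prop. 6.1, "Gysin for bundles"; Voisin I, Lemma 7.32): for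
`q : E → X` between smooth projective complex varieties (`dim X = n`, `dim E = n + r`), Zariski-locally
over `X` isomorphic to `U × ℙʳ → U`, and `s : X → E` with `s ≫ q = 𝟙`, `s^*(Nᵖ H²ᵖ(E)) ⊆ Nᵖ H²ᵖ(X)`.
Proof: expand `y = Σ_{b ≤ min r p} ζᵇ ∪ q^* x_b` (`stub_bundleLerayHirsch`); the coefficients of the
algebraic `y` are algebraic (`stub_lerayHirschReadout`, fed with `stub_bundlePullback` and
`stub_cupDivisor`); `s^* y = Σ_b (s^* ζ)ᵇ ∪ x_b` (`s^* q^* = 𝟙`), `s^* ζ ∈ N¹ H²(X)`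
(`map_mem_algebraicClasses_one`), and `x_b ∪ (s^* ζ)ᵇ ∈ Nᵖ` (`cupProduct_cupPow_mem_algebraicClasses`,
graded commutativity in even degrees). [cite: Fulton1998, Thm. 3.3 (b), Prop. 6.1 and Ex. 19.2.1]
[cite: VoisinHodgeI2002, Lemma 7.32 and §7.3.3] -/
theorem sectionPullback :
    ∀ ⦃n r : ℕ⦄ ⦃X E : SchemeOver ℂ⦄ (q : E ⟶ X) (s : X ⟶ E), IsSmoothProjective n X →
      IsSmoothProjective (n + r) E → s ≫ q = 𝟙 X →
      (∀ x : X.left, ∃ U : X.left.Opens, x ∈ U ∧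
        ∃ φ : (Over.mk ((q.left ⁻¹ᵁ U).ι ≫ E.hom) : SchemeOver ℂ) ≅
            (Over.mk (U.ι ≫ X.hom) : SchemeOver ℂ) ⊗ Motives.projectiveSpace r ℂ,
          φ.hom.left ≫ (fst (Over.mk (U.ι ≫ X.hom) : SchemeOver ℂ)
            (Motives.projectiveSpace r ℂ)).left ≫ U.ι = (q.left ⁻¹ᵁ U).ι ≫ q.left) →
      ∀ (p : ℕ), ∀ y ∈ algebraicClasses E p,
        complexBetti.map s (2 * p) y ∈ algebraicClasses X p := by
  intro n r X E q s hX hE hsq htriv p y hy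
  -- an orientation family (complex points of smooth projective varieties are orientable)
  let μ : OrientationFamily := fun _ _ h ↦ (Motives.ComplexPoints.isOrientableOver ℂ h).some
  obtain ⟨ζ, hζ, ⟨c, hc, hgys⟩, hexp⟩ := stub_bundleLerayHirsch μ q hX hE htriv
  obtain ⟨x, hx⟩ := hexp p y
  -- the coefficients of `y` are algebraic
  have hxalg : ∀ b : Fin (min r p + 1), x b ∈ algebraicClasses X (p - (b : ℕ)) :=
    stub_lerayHirschReadout μ q hX hE (stub_bundlePullback q hX hE htriv) stub_cupDivisor ζ hζ c hc
      hgys p x (hx ▸ hy)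
  -- `s^* q^* = 𝟙`
  have hsq' : ∀ (k : ℕ) (z : complexBetti X k), complexBetti.map s k (complexBetti.map q k z) = z := by
    intro k z
    rw [← CategoryTheory.comp_apply, ← complexBetti.map_comp, hsq, complexBetti.map_id]
    rfl
  -- `s^* ζ` is a divisor class on `X`
  have hsζ : complexBetti.map s (2 * 1) ζ ∈ algebraicClasses X 1 :=
    Theorems.HodgeBeyondAnchors.map_mem_algebraicClasses_one hE hX s hζ
  -- `s^* y = Σ_b (s^* ζ)ᵇ ∪ x_b`
  rw [hx, map_sum]
  refine Submodule.sum_mem _ fun b _ ↦ ?_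
  rw [complexBetti.map, cupProduct_map]
  change cupProduct _ (complexBetti.map s _ (cupPow ℂ ζ b))
    (complexBetti.map s _ (complexBetti.map q _ (x b))) ∈ _
  rw [hsq']
  have hpow : complexBetti.map s (2 * (b : ℕ)) (cupPow ℂ ζ b) =
      cupPow ℂ (complexBetti.map s (2 * 1) ζ) b :=
    map_cupPow ℂ _ ζ b
  rw [hpow, cupProduct_gradedComm_holds ℂ (Motives.ComplexPoints X) _
    (show 2 * (p - (b : ℕ)) + 2 * (b : ℕ) = 2 * p by omega)]
  refine Submodule.smul_mem _ _ ?_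
  exact cupProduct_cupPow_mem_algebraicClasses hX hsζ (hxalg b) b p (by omega) (by omega)

end Summit.HodgeConjecture.HodgeConjecture.Theorems.PullbackAlgebraicNormalCone

end
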